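import Summits.ValiantsHypothesis.ValiantsHypothesis.Theses.RealTau
import Literature.Computability.AlgebraicComplexity.RealTauKnownCases
import Summits.ValiantsHypothesis.ValiantsHypothesis.Theorems.RealTauRealTauRefinedStubWaringSmallK

/-!
# Crux `RealTau.RealTauRefined` (stmt-ValiantsHypothesis-18101), line `fischer-powers` —
# the open core `stub_waringCore` on a PENCIL (coefficient matrix of rank ≤ 2): `≤ 4T(m+1)` zeros

The open stub `stub_waringCore` bounds the distinct real zeros of `G = Σ_{i<K} ε_i h_i^m`,
`h_i = Σ_l c_il X^(e_l)`.  This file settles, for EVERY `K` and without any factor `2^m`, the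
sub-case in which all `h_i` lie in the pencil spanned by two `T`-sparse polynomials `p, q`
(`h_i = α_i p + β_i q`, i.e. the coefficient matrix `c` has rank `≤ 2`): then `G`, if nonzero, has at
most `4 T (m+1)` distinct real zeros (`waring_pencil_card_roots_le`; registered-vocabulary form
`stub_waringCore_rank_le_two`).  Reason: `G = q^m φ(p/q)` for the univariate
`φ(z) = Σ_i ε_i (α_i z + β_i)^m` of degree `≤ m`; `φ ≠ 0` (else `G` vanishes off the zeros of `q`),
so a zero of `G` is a zero of `q` or of `p - z q` for one of the `≤ m` real roots `z` of `φ`, each a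
nonzero `2T`-sparse polynomial (Descartes).  This strictly contains the landed rung `K ≤ 2`
(`stub_waringSmallK`: two rows always have rank `≤ 2`) and is the real-closed shadow of the
factorisation of binary forms; the first sub-case of the core not covered by a one-variable
reduction is coefficient rank `3` — ternary forms of Waring rank `≤ K` on the projected monomial
curve, which already contains Koiran–Portier–Tavenas' "lost theorem" setting (`p = 1`, `q = X`) and
their open two-sparse-curves question.  Calibration lemma for the line, landed `--supports`.
-/

noncomputable section

-- single-conjunct layout: Sub = Summit, duplicated namespace component intended
set_option linter.dupNamespace false

namespace Summit.ValiantsHypothesis.ValiantsHypothesis.Theorems.RealTauRealTauRefined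

open Polynomial Finset
open Literature.Computability.AlgebraicComplexity

/-- Symbolic form of `G` on the line `p = z q` of the pencil: `Σ_i ε_i (α_i (z q) + β_i q)^m =
(Σ_i ε_i (α_i z + β_i)^m) · q^m`. [folklore] -/
theorem waring_pencil_on_line {K : ℕ} (m : ℕ) (ε α β : Fin K → ℝ) (z : ℝ) (q : ℝ[X]) :
    (∑ i, C (ε i) * (C (α i) * (C z * q) + C (β i) * q) ^ m) =
      C (∑ i, ε i * (α i * z + β i) ^ m) * q ^ m := by
  rw [map_sum, sum_mul]
  refine sum_congr rfl fun i _ => ?_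
  have : C (α i) * (C z * q) + C (β i) * q = C (α i * z + β i) * q := by
    rw [map_add, map_mul]; ring
  rw [this, mul_pow, ← map_pow, map_mul, mul_assoc]

/-- The dehomogenised binary form `φ(z) = Σ_i ε_i (α_i z + β_i)^m` has degree `≤ m`. [folklore] -/
theorem natDegree_waring_pencil_aux_le {K : ℕ} (m : ℕ) (ε α β : Fin K → ℝ) :
    (∑ i, C (ε i) * (C (α i) * X + C (β i)) ^ m).natDegree ≤ m := by
  refine natDegree_sum_le_of_forall_le _ _ fun i _ => ?_
  refine (natDegree_C_mul_le _ _).trans ((natDegree_pow_le).trans ?_)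
  have h1 : (C (α i) * X + C (β i)).natDegree ≤ 1 :=
    (natDegree_add_le _ _).trans (max_le ((natDegree_C_mul_le _ _).trans natDegree_X_le)
      ((natDegree_C _).le.trans (Nat.zero_le _)))
  calc m * (C (α i) * X + C (β i)).natDegree ≤ m * 1 := Nat.mul_le_mul_left m h1
    _ = m := mul_one m

/-- **The Waring-on-curve core on a pencil (coefficient rank ≤ 2).** For real `T`-sparse `p, q`,
any `K`, reals `ε_i, α_i, β_i` and any `m`: if `G = Σ_{i<K} ε_i (α_i p + β_i q)^m ≠ 0` then `G` has at
most `4 T (m+1)` distinct real zeros — for every `K`, with no factor `2^m`.  (`q = 0`: `G = c·p^m`;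
otherwise `G(x) = q(x)^m φ(p(x)/q(x))` off the zeros of `q`, `φ(z) = Σ ε_i (α_i z + β_i)^m ≠ 0` of
degree `≤ m`, and the zeros of `G` lie among those of `q` and of the nonzero `2T`-sparse `p - z q`,
`z` a real root of `φ`.) [folklore; real factorisation of binary forms] -/
theorem waring_pencil_card_roots_le (K m T : ℕ) (ε α β : Fin K → ℝ) (p q : ℝ[X])
    (hp : p.support.card ≤ T) (hq : q.support.card ≤ T)
    (hG : (∑ i, C (ε i) * (C (α i) * p + C (β i) * q) ^ m) ≠ 0) :
    (∑ i, C (ε i) * (C (α i) * p + C (β i) * q) ^ m).roots.toFinset.card ≤ 4 * T * (m + 1) := by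
  classical
  set G := ∑ i, C (ε i) * (C (α i) * p + C (β i) * q) ^ m with hGdef
  -- Descartes for a `2T`-sparse member of the pencil
  have hpencil : ∀ z : ℝ, p - C z * q ≠ 0 → (p - C z * q).roots.toFinset.card ≤ 4 * T := by
    intro z hz
    have h1 := card_roots_toFinset_le_of_card_support hz
    have h2 : (p - C z * q).support.card ≤ T + T := by
      rw [sub_eq_add_neg]
      refine (card_le_card support_add).trans ((card_union_le _ _).trans (Nat.add_le_add hp ?_))
      rw [support_neg, C_mul']
      exact (card_le_card (support_smul _ _)).trans hq
    have h3 : 0 < (p - C z * q).support.card :=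
      card_pos.mpr (nonempty_iff_ne_empty.mpr (mt support_eq_empty.mp hz))
    omega
  have hT : p ≠ 0 ∨ q ≠ 0 → 1 ≤ T := by
    rintro (h | h)
    · exact le_trans (card_pos.mpr (nonempty_iff_ne_empty.mpr (mt support_eq_empty.mp h))) hp
    · exact le_trans (card_pos.mpr (nonempty_iff_ne_empty.mpr (mt support_eq_empty.mp h))) hq
  -- `m = 0`: `G` is a constant
  rcases Nat.eq_zero_or_pos m with rfl | hm
  · have h0 : G = C (∑ i, ε i) := by rw [hGdef]; simp [map_sum]
    rw [h0, roots_C, Multiset.toFinset_zero, card_empty]; exact Nat.zero_le _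
  by_cases hq0 : q = 0
  · -- `q = 0`: `G = c · p^m`
    have hGp : G = C (∑ i, ε i * (α i * 1 + β i * 0) ^ m) * p ^ m := by
      have := waring_pencil_on_line m ε α (fun _ => 0) 1 p
      simp only [map_zero, zero_mul, map_one, one_mul] at this
      rw [hGdef, hq0]
      simpa using this
    have hc : (∑ i, ε i * (α i * 1 + β i * 0) ^ m) ≠ 0 := by
      intro h0; apply hG; rw [hGp, h0, map_zero, zero_mul]
    have hp0 : p ≠ 0 := by
      intro h0; apply hG; rw [hGp, h0, zero_pow hm.ne', mul_zero]
    have h1T := hT (Or.inl hp0)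
    rw [hGp, roots_C_mul _ hc]
    calc (p ^ m).roots.toFinset.card ≤ p.roots.toFinset.card := by
          rw [roots_pow, Multiset.toFinset_nsmul _ _ hm.ne']
      _ ≤ 2 * (p.support.card - 1) + 1 := card_roots_toFinset_le_of_card_support hp0
      _ ≤ 2 * T := by omega
      _ ≤ 4 * T * (m + 1) := by nlinarith
  -- `q ≠ 0`: `G(x) = q(x)^m φ(p(x)/q(x))` off the zeros of `q`
  set φ : ℝ[X] := ∑ i, C (ε i) * (C (α i) * X + C (β i)) ^ m with hφ
  have hφeval : ∀ z : ℝ, φ.eval z = ∑ i, ε i * (α i * z + β i) ^ m := by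
    intro z; simp [hφ, eval_finsetSum]
  have hGeval : ∀ x : ℝ, q.eval x ≠ 0 →
      G.eval x = (q.eval x) ^ m * φ.eval (p.eval x / q.eval x) := by
    intro x hx
    rw [hφeval, hGdef, eval_finsetSum, mul_sum]
    refine sum_congr rfl fun i _ => ?_
    simp only [eval_mul, eval_C, eval_pow, eval_add]
    have : α i * p.eval x + β i * q.eval x = q.eval x * (α i * (p.eval x / q.eval x) + β i) := by
      field_simp
    rw [this, mul_pow]; ring
  -- `φ ≠ 0`, else `G` vanishes on the cofinite set `{q ≠ 0}`
  have hφ0 : φ ≠ 0 := by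
    intro h0
    apply hG
    refine eq_zero_of_infinite_isRoot G ?_
    have hinf : Set.Infinite ((↑q.roots.toFinset : Set ℝ)ᶜ) := (Finset.finite_toSet _).infinite_compl
    refine hinf.mono fun x hx => ?_
    have hqx : q.eval x ≠ 0 := by
      intro h; apply hx
      simp only [mem_coe, Multiset.mem_toFinset]
      exact (mem_roots hq0).mpr h
    show G.eval x = 0
    rw [hGeval x hqx, h0, eval_zero, mul_zero]
  -- on the line `p = z q` the sum is `φ(z) q^m`
  have hline : ∀ z : ℝ, p = C z * q → G = C (φ.eval z) * q ^ m := by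
    intro z hz; rw [hGdef, hz, hφeval]; exact waring_pencil_on_line m ε α β z q
  -- containment of the zero set
  have hcont : G.roots.toFinset ⊆ q.roots.toFinset ∪
      φ.roots.toFinset.biUnion (fun z => (p - C z * q).roots.toFinset) := by
    intro x hx
    rw [Multiset.mem_toFinset, mem_roots hG, IsRoot.def] at hx
    by_cases hqx : q.eval x = 0
    · exact mem_union_left _ (Multiset.mem_toFinset.mpr ((mem_roots hq0).mpr hqx))
    · refine mem_union_right _ (mem_biUnion.mpr ⟨p.eval x / q.eval x, ?_, ?_⟩)
      · rw [Multiset.mem_toFinset, mem_roots hφ0, IsRoot.def]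
        have h1 := hGeval x hqx
        rw [hx] at h1
        rcases mul_eq_zero.mp h1.symm with h | h
        · exact absurd (pow_eq_zero_iff' |>.mp h).1 hqx
        · exact h
      · have hne : p - C (p.eval x / q.eval x) * q ≠ 0 := by
          intro h0
          have hpz : p = C (p.eval x / q.eval x) * q := sub_eq_zero.mp h0
          have h1 := hline _ hpz
          have h2 : φ.eval (p.eval x / q.eval x) = 0 := by
            have h3 := hGeval x hqx
            rw [hx] at h3
            rcases mul_eq_zero.mp h3.symm with h | h
            · exact absurd (pow_eq_zero_iff' |>.mp h).1 hqx
            · exact h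
          apply hG; rw [h1, h2, map_zero, zero_mul]
        rw [Multiset.mem_toFinset, mem_roots hne, IsRoot.def, eval_sub, eval_mul, eval_C]
        field_simp; ring
  -- counting
  have hφroots : φ.roots.toFinset.card ≤ m :=
    (Multiset.toFinset_card_le _).trans ((card_roots' φ).trans (natDegree_waring_pencil_aux_le m ε α β))
  have hq1 : q.roots.toFinset.card ≤ 2 * T := by
    have := card_roots_toFinset_le_of_card_support hq0
    have h3 : 0 < q.support.card :=
      card_pos.mpr (nonempty_iff_ne_empty.mpr (mt support_eq_empty.mp hq0))
    omega
  calc G.roots.toFinset.card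
      ≤ (q.roots.toFinset ∪ φ.roots.toFinset.biUnion (fun z => (p - C z * q).roots.toFinset)).card :=
        card_le_card hcont
    _ ≤ q.roots.toFinset.card + ∑ z ∈ φ.roots.toFinset, (p - C z * q).roots.toFinset.card :=
        (card_union_le _ _).trans (Nat.add_le_add_left card_biUnion_le _)
    _ ≤ 2 * T + ∑ _z ∈ φ.roots.toFinset, 4 * T := by
        refine Nat.add_le_add hq1 (sum_le_sum fun z _ => ?_)
        by_cases hz : p - C z * q = 0
        · rw [hz, roots_zero, Multiset.toFinset_zero, card_empty]; exact Nat.zero_le _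
        · exact hpencil z hz
    _ = 2 * T + φ.roots.toFinset.card * (4 * T) := by rw [sum_const, smul_eq_mul]
    _ ≤ 2 * T + m * (4 * T) := Nat.add_le_add_left (Nat.mul_le_mul_right _ hφroots) _
    _ ≤ 4 * T * (m + 1) := by nlinarith

/-- **Registered-vocabulary form (`stub_waringCore` restricted to coefficient matrices of rank
≤ 2, all `K`, all `m`, all exponents `e`).** If `c_il = α_i P_l + β_i Q_l` then the Waring-on-curve
sum `Σ_{i<K} ε_i (Σ_l c_il X^(e_l))^m`, if nonzero, has at most `4 T (m+1)` distinct real zeros.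
Contains the landed rung `K ≤ 2` (`stub_waringSmallK`) and needs neither `3 ≤ K`, `3 ≤ m`,
`m + 2 ≤ T` nor `StrictMono e`. [folklore] -/
theorem stub_waringCore_rank_le_two :
    ∀ (K m T : ℕ) (ε : Fin K → ℤˣ) (c : Fin K → Fin T → ℝ) (e : Fin T → ℕ) (α β : Fin K → ℝ)
      (P Q : Fin T → ℝ), (∀ i l, c i l = α i * P l + β i * Q l) →
      (∑ i, C (((ε i : ℤ) : ℝ)) * (∑ l, C (c i l) * X ^ (e l)) ^ m) ≠ 0 →
        (∑ i, C (((ε i : ℤ) : ℝ)) * (∑ l, C (c i l) * X ^ (e l)) ^ m).roots.toFinset.card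
          ≤ 4 * T * (m + 1) := by
  intro K m T ε c e α β P Q hc hG
  set p : ℝ[X] := ∑ l, C (P l) * X ^ (e l) with hpdef
  set q : ℝ[X] := ∑ l, C (Q l) * X ^ (e l) with hqdef
  have hrow : ∀ i, (∑ l, C (c i l) * X ^ (e l)) = C (α i) * p + C (β i) * q := by
    intro i
    rw [hpdef, hqdef, mul_sum, mul_sum, ← sum_add_distrib]
    refine sum_congr rfl fun l _ => ?_
    rw [hc i l, map_add, map_mul, map_mul]; ring
  simp_rw [hrow] at hG ⊢
  exact waring_pencil_card_roots_le K m T (fun i => (((ε i : ℤ) : ℝ))) α β p q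
    (card_support_linForm_le P e) (card_support_linForm_le Q e) hG

end Summit.ValiantsHypothesis.ValiantsHypothesis.Theorems.RealTauRealTauRefined
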